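import Summits.Ventures.PercRepro.ProfilePointedCircuitClassesStarSharpV

/-!
# PercRepro — (★) AT `(7, 4)` FROM THE SHARP STATEMENT, PART A — THE PARALLEL PAIR AND THE SERIES EXTENSION: `in_3(e) ≤ in_3(f) + thru_3({e, f})` ON EVERY COLOOP-FREE
RANK-4 MATROID ON SEVEN POINTS (p5, gen 56; `proofs/P5-GM1.md` §84 ADD 1)

The series extension `N = R ⊕ {b, b′}` of a coloop-free rank-4 matroid `R` on seven points by a parallel pair
`{b, b′}` (the rank-1 matroid `parallelPair b b′`, Mathlib's `Matroid.disjointSum`) is a coloop-free nine-point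
matroid of rank 5 in which `{b, b′}` is a series pair (`seriesExt_hyps`); its bi-independent `4`-sets are exactly the
lifts `Y + b`, `Y + b′` of the bi-independent `3`-sets `Y` of `R` (`insert_mem_biIndepSets_seriesExt`,
`mem_biIndepSets_seriesExt`; the rank of a subset of a disjoint sum is the sum of the ranks of its traces,
`eRk_disjointSum`), so every count over `N` is the sum of two lifted counts (`card_filter_biIndepSets_seriesExt`),
and the Sharp inequality of `N` at `(e, f)` (`starNineSharp_holds`) reads `2·in_3(e) + in_3(f) + thru_3 ≤
2·in_3(f) + 2·thru_3 + in_3(e)` — i.e. (★)₇ (`starSeven_of_seriesExt`; the two spare points `b ≠ b′` outside `R`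
are a hypothesis on the ambient type).
-/

open scoped Matroid

namespace PercRepro.Cogirth

open Finset ThmH Skew Shadow Profile

open Classical

variable {α : Type} [DecidableEq α]

section StarSevenA

/-- **THE PARALLEL PAIR** `{b, b′}`: the rank-1 matroid on two points, with bases `{b}` and `{b′}`. -/
noncomputable def parallelPair (b b' : α) : Matroid α :=
  Matroid.ofIsBaseOfFinite (E := ({b, b'} : Set α)) (Set.toFinite _) (fun B => B = {b} ∨ B = {b'})
    ⟨{b}, Or.inl rfl⟩
    (by
      intro X Y hX hY a ha
      rcases hX with rfl | rfl <;> rcases hY with rfl | rfl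
      · exact absurd ha (by simp)
      · have hab : a = b := Set.mem_singleton_iff.1 ((Set.mem_sdiff _).1 ha).1
        have hbb' : b ≠ b' := fun h => ((Set.mem_sdiff _).1 ha).2 (by rw [hab, h]; exact Set.mem_singleton _)
        refine ⟨b', ⟨Set.mem_singleton _, fun h => hbb' (Set.mem_singleton_iff.1 h).symm⟩, Or.inr ?_⟩
        rw [hab, Set.sdiff_self, insert_empty_eq]
      · have hab : a = b' := Set.mem_singleton_iff.1 ((Set.mem_sdiff _).1 ha).1
        have hbb' : b ≠ b' := fun h => ((Set.mem_sdiff _).1 ha).2 (by rw [hab, h]; exact Set.mem_singleton _)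
        refine ⟨b, ⟨Set.mem_singleton _, fun h => hbb' (Set.mem_singleton_iff.1 h)⟩, Or.inl ?_⟩
        rw [hab, Set.sdiff_self, insert_empty_eq]
      · exact absurd ha (by simp))
    (by
      intro B hB
      rcases hB with rfl | rfl
      · exact Set.singleton_subset_iff.2 (by simp)
      · exact Set.singleton_subset_iff.2 (by simp))

omit [DecidableEq α] in
/-- The ground set of the parallel pair is `{b, b′}`. -/
theorem parallelPair_ground (b b' : α) : (parallelPair b b').E = {b, b'} := rfl

omit [DecidableEq α] in
/-- The bases of the parallel pair are `{b}` and `{b′}`. -/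
theorem parallelPair_isBase_iff {b b' : α} {B : Set α} : (parallelPair b b').IsBase B ↔ B = {b} ∨ B = {b'} :=
  Iff.rfl

omit [DecidableEq α] in
/-- The independent sets of the parallel pair are the subsets of `{b}` and of `{b′}`. -/
theorem parallelPair_indep_iff {b b' : α} {I : Set α} : (parallelPair b b').Indep I ↔ I ⊆ {b} ∨ I ⊆ {b'} := by
  rw [Matroid.indep_iff]
  constructor
  · rintro ⟨B, hB, hIB⟩
    rcases parallelPair_isBase_iff.1 hB with rfl | rfl
    · exact Or.inl hIB
    · exact Or.inr hIB
  · rintro (h | h)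
    · exact ⟨{b}, Or.inl rfl, h⟩
    · exact ⟨{b'}, Or.inr rfl, h⟩

omit [DecidableEq α] in
/-- The parallel pair is a finite matroid. -/
instance parallelPair_finite (b b' : α) : (parallelPair b b').Finite :=
  ⟨(Set.toFinite ({b, b'} : Set α))⟩

omit [DecidableEq α] in
/-- **THE RANK OF A SUBSET OF A DISJOINT SUM** is the sum of the ranks of its two traces. -/
theorem eRk_disjointSum (M N : Matroid α) (h : Disjoint M.E N.E) (X : Set α) (hX : X ⊆ M.E ∪ N.E) :
    (M.disjointSum N h).eRk X = M.eRk (X ∩ M.E) + N.eRk (X ∩ N.E) := by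
  obtain ⟨I, hI⟩ := M.exists_isBasis (X ∩ M.E) Set.inter_subset_right
  obtain ⟨J, hJ⟩ := N.exists_isBasis (X ∩ N.E) Set.inter_subset_right
  have hIM : I ⊆ M.E := hI.indep.subset_ground
  have hJN : J ⊆ N.E := hJ.indep.subset_ground
  have hIJdis : Disjoint I J := h.mono hIM hJN
  have hIJ : (M.disjointSum N h).IsBasis (I ∪ J) X := by
    rw [Matroid.disjointSum_isBasis_iff]
    refine ⟨?_, ?_, ?_, hX⟩
    · have : (I ∪ J) ∩ M.E = I := by
        rw [Set.union_inter_distrib_right, Set.inter_eq_left.2 hIM, (h.symm.mono hJN le_rfl).inter_eq, Set.union_empty]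
      rw [this]; exact hI
    · have : (I ∪ J) ∩ N.E = J := by
        rw [Set.union_inter_distrib_right, Set.inter_eq_left.2 hJN, (h.mono hIM le_rfl).inter_eq, Set.empty_union]
      rw [this]; exact hJ
    · exact Set.union_subset (hI.subset.trans Set.inter_subset_left) (hJ.subset.trans Set.inter_subset_left)
  rw [← hIJ.encard_eq_eRk, ← hI.encard_eq_eRk, ← hJ.encard_eq_eRk, Set.encard_union_eq hIJdis]

end StarSevenA

section StarSevenB

/-- **THE SERIES EXTENSION** `N = R ⊕ {b, b′}` with `b ∥ b′` (so `{b, b′}` is a series pair of `N` as well). -/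
noncomputable def seriesExt (R : Matroid α) (b b' : α) (h : Disjoint R.E {b, b'}) : Matroid α :=
  R.disjointSum (parallelPair b b') h

omit [DecidableEq α] in
/-- The series extension of a finite matroid is finite. -/
instance seriesExt_finite (R : Matroid α) [R.Finite] (b b' : α) (h : Disjoint R.E {b, b'}) :
    (seriesExt R b b' h).Finite :=
  ⟨by unfold seriesExt; rw [Matroid.disjointSum_ground_eq]; exact R.ground_finite.union (parallelPair b b').ground_finite⟩

omit [DecidableEq α] in
/-- The ground set of the series extension is `E(R) ∪ {b, b′}`. -/
theorem seriesExt_ground (R : Matroid α) (b b' : α) (h : Disjoint R.E {b, b'}) :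
    (seriesExt R b b' h).E = R.E ∪ {b, b'} := by
  unfold seriesExt; rw [Matroid.disjointSum_ground_eq]; rfl

omit [DecidableEq α] in
/-- Independence in the series extension: the trace on `R` is independent and the trace on `{b, b′}` has at most one point. -/
theorem seriesExt_indep_iff (R : Matroid α) (b b' : α) (h : Disjoint R.E {b, b'}) {I : Set α} :
    (seriesExt R b b' h).Indep I ↔ R.Indep (I ∩ R.E) ∧ (I ∩ {b, b'} ⊆ {b} ∨ I ∩ {b, b'} ⊆ {b'}) ∧ I ⊆ R.E ∪ {b, b'} := by
  unfold seriesExt; rw [Matroid.disjointSum_indep_iff, parallelPair_indep_iff]; rfl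

variable {R : Matroid α} [R.Finite] {b b' : α} {h : Disjoint R.E {b, b'}}

/-- `gr N = gr R ∪ {b, b′}` as finsets. -/
theorem gr_seriesExt : gr (seriesExt R b b' h) = gr R ∪ {b, b'} := by
  apply Finset.coe_injective
  rw [coe_gr, coe_union, coe_gr, seriesExt_ground, coe_pair]

/-- The rank of a subset of `N` is the sum of the ranks of its traces on `R` and on `{b, b′}`. -/
theorem rk_seriesExt (X : Finset α) (hX : X ⊆ gr (seriesExt R b b' h)) :
    rk (seriesExt R b b' h) X = rk R (X ∩ gr R) + rk (parallelPair b b') (X ∩ {b, b'}) := by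
  have hX' : (X : Set α) ⊆ R.E ∪ {b, b'} := by
    rw [← seriesExt_ground R b b' h, ← coe_gr]; exact coe_subset.2 hX
  have h1 := eRk_disjointSum R (parallelPair b b') h (X : Set α) hX'
  have h2 := coe_rk (M := seriesExt R b b' h) X
  have h3 := coe_rk (M := R) (X ∩ gr R)
  have h4 := coe_rk (M := parallelPair b b') (X ∩ {b, b'})
  rw [coe_inter, coe_gr] at h3
  rw [coe_inter, coe_pair] at h4
  have h5 : ((rk (seriesExt R b b' h) X : ℕ) : ℕ∞) =
      ((rk R (X ∩ gr R) + rk (parallelPair b b') (X ∩ {b, b'}) : ℕ) : ℕ∞) := by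
    rw [Nat.cast_add, h2, h3, h4]
    exact h1
  exact_mod_cast h5

omit [DecidableEq α] in
/-- `{b}` has rank 1 in the parallel pair. -/
theorem eRk_parallelPair_singleton_left (b b' : α) : (parallelPair b b').eRk {b} = 1 := by
  rw [Matroid.Indep.eRk_eq_encard (parallelPair_indep_iff.2 (Or.inl le_rfl)), Set.encard_singleton]

omit [DecidableEq α] in
/-- `{b′}` has rank 1 in the parallel pair. -/
theorem eRk_parallelPair_singleton_right (b b' : α) : (parallelPair b b').eRk {b'} = 1 := by
  rw [Matroid.Indep.eRk_eq_encard (parallelPair_indep_iff.2 (Or.inr le_rfl)), Set.encard_singleton]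

omit [DecidableEq α] in
/-- `{b, b′}` has rank 1 in the parallel pair. -/
theorem eRk_parallelPair_pair (b b' : α) : (parallelPair b b').eRk {b, b'} = 1 := by
  have h1 : (parallelPair b b').eRk {b, b'} = (parallelPair b b').eRank := by
    rw [← Matroid.eRk_ground]; rfl
  rw [h1, ← Matroid.IsBase.encard_eq_eRank (parallelPair_isBase_iff.2 (Or.inl rfl)), Set.encard_singleton]

/-- The rank of the trace of `X` on `{b, b′}`: `1` if `X` meets the pair, else `0`. -/
theorem rk_parallelPair_inter (X : Finset α) :
    rk (parallelPair b b') (X ∩ {b, b'}) = (if b ∈ X ∨ b' ∈ X then 1 else 0) := by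
  have hc := coe_rk (M := parallelPair b b') (X ∩ {b, b'})
  rw [coe_inter, coe_pair] at hc
  by_cases hb : b ∈ X <;> by_cases hb' : b' ∈ X
  · have : (X : Set α) ∩ {b, b'} = {b, b'} := Set.inter_eq_right.2 (by
      rintro z (rfl | rfl)
      · exact mem_coe.2 hb
      · exact mem_coe.2 hb')
    rw [this, eRk_parallelPair_pair] at hc
    simp only [hb, hb', true_or, if_true]
    exact_mod_cast hc
  · have : (X : Set α) ∩ {b, b'} = {b} := by
      ext z; simp only [Set.mem_inter_iff, mem_coe, Set.mem_insert_iff, Set.mem_singleton_iff]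
      constructor
      · rintro ⟨hz, rfl | rfl⟩
        · rfl
        · exact absurd hz hb'
      · rintro rfl; exact ⟨hb, Or.inl rfl⟩
    rw [this, eRk_parallelPair_singleton_left] at hc
    simp only [hb, true_or, if_true]
    exact_mod_cast hc
  · have : (X : Set α) ∩ {b, b'} = {b'} := by
      ext z; simp only [Set.mem_inter_iff, mem_coe, Set.mem_insert_iff, Set.mem_singleton_iff]
      constructor
      · rintro ⟨hz, rfl | rfl⟩
        · exact absurd hz hb
        · rfl
      · rintro rfl; exact ⟨hb', Or.inr rfl⟩
    rw [this, eRk_parallelPair_singleton_right] at hc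
    simp only [hb, hb', or_true, if_true]
    exact_mod_cast hc
  · have : (X : Set α) ∩ {b, b'} = ∅ := by
      ext z; simp only [Set.mem_inter_iff, mem_coe, Set.mem_insert_iff, Set.mem_singleton_iff, Set.mem_empty_iff_false,
        iff_false, not_and]
      rintro hz (rfl | rfl)
      · exact hb hz
      · exact hb' hz
    rw [this, Matroid.eRk_empty] at hc
    simp only [hb, hb', or_self, if_false]
    exact_mod_cast hc

end StarSevenB

end PercRepro.Cogirth
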